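import Summits.NavierStokesRegularity.NavierStokesRegularity.Theorems.ApexLocalisation.Negative.BridgeVacuity
import Literature.Analysis.FluidPDE.LocalTypeICongr

/-!
# `ApexLocalisation` (crux stmt-NavierStokesRegularity-11719): the PICKED line `decaying-ancient-bridge`
# — blow-down modulo the engine (closes `stub_apexOfDecaying`) — negative-side support (drefute seat, gen 3)

Companion of `Negative/BridgeTargets.lean` / `Negative/BridgeVacuity.lean` for the lead's skeleton
`Cruxes/ApexLocalisation/Lines/decaying-ancient-bridge.lean` (sha `adc980f7…`, stubs `stub_slabCompactness`
(ENGINE), `stub_rateToAncient`, `stub_radiationBound`, `stub_hullSelection` (THE BET), `stub_hullClosed`,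
`stub_apexOfDecaying`). All sorry-free.

* §0 the engine and the ⇐ transfer as named propositions, VERBATIM (`SlabEngine`, `ApexOfDecayingCore`;
  conformance `example` at the end), and `ClassGivesRateProfile` ("every non-trivial member of the line's
  class 𝒜(C,B) = `InBridgeClass` yields a rate-Type-I singular slab profile").
* §2 **BLOW-DOWN MODULO THE ENGINE** (`blowDown_of_slabEngine`): granted `SlabEngine`, any suitable weak slab
  solution with weak gradient, `𝐈 < ⊤`, not a.e. zero, all of whose Navier–Stokes zooms about the origin
  `c N(c²t, cx)` (`c ≥ 1`) obey a fixed majorant `F`, blows down to a suitable weak slab solution with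
  `𝐈 < ⊤`, backward-singular at the origin, obeying `F` a.e. (Albritton–Barker 2019 §3, reverse direction,
  run on the whole slab: zoom covariance `zoom_isSuitableWeakSolutionOn`, `typeIBound_lowerHalf_nsZoom`,
  persistence through `‖v_k‖_{L^∞(Q(0,R))} → ∞` (`tendsto_eLpNorm_top_originZoom_atTop`), a.e. limits of
  the `L³_loc` limits ball by ball). Corollaries:
  - `apexOfDecayingCore_of_slabEngine` : **`stub_apexOfDecaying` holds outright** — its own antecedent is
    the engine; `F = C'/(‖x‖+√(−t))` from the shifted decay (`c C'/(1+c‖x‖+c√−t) ≤ C'/(‖x‖+√−t)`) and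
    `exists_apex_profile_repr`. (The verbatim type of the stub is the final `example`.)
  - `classGivesRateProfile_of_slabEngine` : `SlabEngine → ClassGivesRateProfile` (`F = C/√(−t)`,
    `exists_rate_profile_repr`) — A–B Thm 1.1 reverse WITH the rate, for 𝒜(C,B); consumed by
    `Negative/BridgeBetOptimality.lean` (under the route target the bet ⇔ the crux).

## References

* D. Albritton, T. Barker, J. Math. Fluid Mech. 21 (2019) = arXiv:1811.00502, Thm 1.1, Lemma 2.2,
  Prop. 2.3, §3. [AlbrittonBarker2019]
* G. Koch, N. Nadirashvili, G. Seregin, V. Šverák, Acta Math. 203 (2009), (1.4), (1.6), §6. [KNSS2009]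
-/

set_option linter.dupNamespace false

noncomputable section

open MeasureTheory TopologicalSpace Set Function Filter Topology Metric
open scoped InnerProductSpace RealInnerProductSpace ENNReal NNReal
open Literature.Analysis Literature.Analysis.FluidPDE
open Summit.NavierStokesRegularity.NavierStokesRegularity.Theses

namespace Summit.NavierStokesRegularity.NavierStokesRegularity.Theorems.ApexLocalisation.Negative

/-- Physical space (the skeleton writes `E³`). -/
local notation "E³" => EuclideanSpace ℝ (Fin 3)

/-! ## §0 The engine and the ⇐ transfer as named propositions (verbatim from the skeleton) -/

/-- `stub_slabCompactness` (the ENGINE), verbatim. -/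
def SlabEngine : Prop :=
  ∀ (I : ℝ≥0∞) (v : ℕ → ℝ → E³ → E³) (q : ℕ → ℝ → E³ → ℝ) (G : ℕ → ℝ → E³ → E³ →L[ℝ] E³),
      I < ⊤ →
      (∀ k, IsSuitableWeakSolutionOn (slab E³ (Iio 0) isOpen_Iio) 1 0 (v k) (q k)) →
      (∀ k, HasWeakSpatialGradientOn (slab E³ (Iio 0) isOpen_Iio) (v k) (G k)) →
      (∀ k, typeIBound (Iio (0 : ℝ) ×ˢ univ) (v k) (q k) (G k) ≤ I) →
      ∃ (u : ℝ → E³ → E³) (p : ℝ → E³ → ℝ) (H : ℝ → E³ → E³ →L[ℝ] E³) (σ : ℕ → ℕ),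
        StrictMono σ ∧
        IsSuitableWeakSolutionOn (slab E³ (Iio 0) isOpen_Iio) 1 0 u p ∧
        HasWeakSpatialGradientOn (slab E³ (Iio 0) isOpen_Iio) u H ∧
        typeIBound (Iio (0 : ℝ) ×ˢ univ) u p H ≤ 4 * I ∧
        (∀ R : ℝ, 0 < R → Tendsto (fun j => eLpNorm (uncurry (v (σ j)) - uncurry u) 3
          (volume.restrict (parabolicCylinder R (0 : ℝ × E³)))) atTop (𝓝 0)) ∧
        ((∀ R : ℝ, 0 < R → limsup (fun j => eLpNorm (uncurry (v (σ j))) ⊤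
            (volume.restrict (parabolicCylinder R (0 : ℝ × E³)))) atTop = ⊤) →
          IsBackwardSingularPoint u 0)
/-- The consequent of `stub_apexOfDecaying` (⇐ TRANSFER) after the engine is fed, verbatim. -/
def ApexOfDecayingCore : Prop :=
  (∃ (C' : ℝ) (N : ℝ → E³ → E³) (q : ℝ → E³ → ℝ) (H : ℝ → E³ → E³ →L[ℝ] E³),
      IsSuitableWeakSolutionOn (slab E³ (Iio 0) isOpen_Iio) 1 0 N q ∧
      HasWeakSpatialGradientOn (slab E³ (Iio 0) isOpen_Iio) N H ∧
      typeIBound (Iio (0 : ℝ) ×ˢ univ) N q H < ⊤ ∧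
      ¬ (uncurry N =ᵐ[volume.restrict (Iio (0 : ℝ) ×ˢ (univ : Set E³))] 0) ∧
      ∀ t : ℝ, t < 0 → ∀ x : E³, ‖N t x‖ ≤ C' / (1 + ‖x‖ + Real.sqrt (-t))) →
    ∃ (C' : ℝ) (u : ℝ → E³ → E³) (p : ℝ → E³ → ℝ) (G : ℝ → E³ → E³ →L[ℝ] E³),
      IsSuitableWeakSolutionOn (slab E³ (Iio 0) isOpen_Iio) 1 0 u p ∧
      HasWeakSpatialGradientOn (slab E³ (Iio 0) isOpen_Iio) u G ∧
      typeIBound (Iio (0 : ℝ) ×ˢ univ) u p G < ⊤ ∧ HasTypeIDecay C' u ∧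
      IsBackwardSingularPoint u 0

/-- **A–B reverse WITH the rate, for the line's class** (the one analytic input of §1 that is not a
stub of the line; discharged modulo the engine in §2): every non-trivial member of 𝒜(C,B) yields a
rate-Type-I singular slab profile. -/
def ClassGivesRateProfile : Prop :=
  ∀ (C B : ℝ) (M : ℝ → E³ → E³), InBridgeClass C B M →
    (∃ s : ℝ, s < 0 ∧ ∃ y : E³, M s y ≠ 0) → RateProfileExists

/-! ## §2 Blow-down modulo the engine -/

/-- **Blow-up of the `L^∞` norms along zooms ABOUT THE ORIGIN** (variant of the tree's
`tendsto_eLpNorm_top_nsZoom_atTop`, which zooms about the non-triviality centre `z₁` itself): if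
`‖u‖_{L^∞(Q(z₁,1))} ≠ 0` for some `z₁` with `t₁ < 0` and `c_k → ∞`, then
`‖c_k u(c_k² ·, c_k ·)‖_{L^∞(Q(0,R))} = c_k ‖u‖_{L^∞(Q(0,c_k R))} → ∞`, because `Q(z₁,1) ⊆ Q(0, c_k R)`
eventually. -/
theorem tendsto_eLpNorm_top_originZoom_atTop {u : ℝ → E³ → E³} {z₁ : ℝ × E³} (hz₁ : z₁.1 < 0)
    {c : ℕ → ℝ} (hc : ∀ k, 0 < c k) (hctop : Tendsto c atTop atTop)
    (hN : eLpNorm (uncurry u) ∞ (volume.restrict (parabolicCylinder 1 z₁)) ≠ 0) {R : ℝ}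
    (hR : 0 < R) :
    Tendsto (fun k => eLpNorm (uncurry ((c k) • stPull (c k ^ 2) (c k) 0 (0 : E³) u)) ∞
      (volume.restrict (parabolicCylinder R 0))) atTop (𝓝 ∞) := by
  set N := eLpNorm (uncurry u) ∞ (volume.restrict (parabolicCylinder 1 z₁)) with hNdef
  have hb : Tendsto (fun k => ENNReal.ofReal (c k) * N) atTop (𝓝 ∞) := by
    have h1 : Tendsto (fun k => ENNReal.ofReal (c k)) atTop (𝓝 ∞) :=
      ENNReal.tendsto_ofReal_atTop.comp hctop
    have h2 := ENNReal.Tendsto.mul_const h1 (Or.inl ENNReal.top_ne_zero) (b := N)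
    rwa [ENNReal.top_mul hN] at h2
  refine tendsto_nhds_top_mono hb ?_
  -- eventually `c_k R ≥ A := 2 - t₁ + ‖x₁‖`, and then `Q(z₁,1) ⊆ Q(0, c_k R)`
  set A : ℝ := 2 - z₁.1 + ‖z₁.2‖ with hA
  have hA1 : 1 ≤ A := by
    have := norm_nonneg z₁.2
    rw [hA]; linarith
  filter_upwards [hctop.eventually_ge_atTop (A / R)] with k hk
  have hcR : A ≤ c k * R := by
    have := mul_le_mul_of_nonneg_right hk hR.le
    rwa [div_mul_cancel₀ _ hR.ne'] at this
  have h0 : stAffine (c k ^ 2) (c k) 0 (0 : E³) 0 = 0 := by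
    ext <;> simp [stAffine]
  rw [eLpNorm_top_nsZoom (hc k) 0 (0 : E³) R 0, h0]
  gcongr
  refine eLpNorm_mono_measure _ (Measure.restrict_mono ?_ le_rfl)
  -- `Q(z₁, 1) ⊆ Q(0, c_k R)`
  intro w hw
  rw [mem_parabolicCylinder] at hw ⊢
  obtain ⟨⟨hw1, hw2⟩, hw3⟩ := hw
  have hsq : A ≤ (c k * R) ^ 2 := by nlinarith
  refine ⟨⟨?_, ?_⟩, ?_⟩
  · simp only [Prod.fst_zero]
    rw [hA] at hsq
    have := norm_nonneg z₁.2
    linarith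
  · simp only [Prod.fst_zero]
    linarith
  · simp only [Prod.snd_zero]
    calc dist w.2 0 ≤ dist w.2 z₁.2 + dist z₁.2 0 := dist_triangle _ _ _
      _ < 1 + ‖z₁.2‖ := by rw [dist_zero_right]; linarith
      _ ≤ c k * R := by rw [hA] at hcR; linarith

/-- The slab `(-∞,0) × ℝ³` is covered by the parabolic balls `Q(0, n+1)`. -/
theorem slab_subset_iUnion_parabolicCylinder :
    (Iio (0 : ℝ) ×ˢ (univ : Set E³)) ⊆ ⋃ n : ℕ, parabolicCylinder ((n : ℝ) + 1) (0 : ℝ × E³) := by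
  rintro ⟨t, x⟩ ⟨ht, -⟩
  simp only [mem_Iio] at ht
  obtain ⟨n, hn⟩ := exists_nat_gt (max (-t) ‖x‖)
  have hn1 : -t < n := lt_of_le_of_lt (le_max_left _ _) hn
  have hn2 : ‖x‖ < n := lt_of_le_of_lt (le_max_right _ _) hn
  refine mem_iUnion.2 ⟨n, ?_⟩
  rw [mem_parabolicCylinder]
  refine ⟨⟨?_, by simpa using ht⟩, ?_⟩
  · simp only [Prod.fst_zero]
    have h0 : (0 : ℝ) ≤ n := n.cast_nonneg
    nlinarith
  · simpa [dist_zero_right] using (hn2.trans (by linarith : (n : ℝ) < n + 1))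

/-- **BLOW-DOWN MODULO THE ENGINE.** Granted `SlabEngine` (`stub_slabCompactness`), a suitable weak
slab solution `N` with weak gradient, `𝐈 < ⊤`, not a.e. zero, all of whose NS zooms about the origin
`c N(c²t, cx)`, `c ≥ 1`, obey a fixed majorant `F`, blows down (along `c_k = k+1`, then the engine's
subsequence) to a suitable weak slab solution with `𝐈 < ⊤`, backward-singular at the origin
(persistence: `‖v_k‖_{L^∞(Q(0,R))} → ∞`) and obeying `F` almost everywhere on the slab (a.e.
limits of `L³_loc` limits). -/
theorem blowDown_of_slabEngine (hE : SlabEngine)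
    {N : ℝ → E³ → E³} {q : ℝ → E³ → ℝ} {H : ℝ → E³ → E³ →L[ℝ] E³}
    (hsws : IsSuitableWeakSolutionOn (slab E³ (Iio 0) isOpen_Iio) 1 0 N q)
    (hgrad : HasWeakSpatialGradientOn (slab E³ (Iio 0) isOpen_Iio) N H)
    (hI : typeIBound (Iio (0 : ℝ) ×ˢ univ) N q H < ⊤)
    (hnt : ¬ (uncurry N =ᵐ[volume.restrict (Iio (0 : ℝ) ×ˢ (univ : Set E³))] 0))
    {F : ℝ × E³ → ℝ}
    (hF : ∀ c : ℝ, 1 ≤ c → ∀ t : ℝ, t < 0 → ∀ x : E³, ‖c • N (c ^ 2 * t) (c • x)‖ ≤ F (t, x)) :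
    ∃ (u : ℝ → E³ → E³) (p : ℝ → E³ → ℝ) (G : ℝ → E³ → E³ →L[ℝ] E³),
      IsSuitableWeakSolutionOn (slab E³ (Iio 0) isOpen_Iio) 1 0 u p ∧
      HasWeakSpatialGradientOn (slab E³ (Iio 0) isOpen_Iio) u G ∧
      typeIBound (Iio (0 : ℝ) ×ˢ univ) u p G < ⊤ ∧ IsBackwardSingularPoint u 0 ∧
      ∀ᵐ w ∂(volume.restrict (Iio (0 : ℝ) ×ˢ (univ : Set E³))), ‖uncurry u w‖ ≤ F w := by
  set I := typeIBound (Iio (0 : ℝ) ×ˢ (univ : Set E³)) N q H with hIdef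
  -- non-triviality centre
  have hNm : AEStronglyMeasurable (uncurry N) (volume.restrict (Iio (0 : ℝ) ×ˢ (univ : Set E³))) :=
    hgrad.locallyIntegrableOn.aestronglyMeasurable
  obtain ⟨z₁, hz₁, hNz⟩ := exists_center_eLpNorm_top_ne_zero hNm hnt
  -- the blow-down family about the origin
  set c : ℕ → ℝ := fun k => (k : ℝ) + 1 with hc
  have hcpos : ∀ k, 0 < c k := fun k => by positivity
  have hc1 : ∀ k, 1 ≤ c k := fun k => by
    show (1 : ℝ) ≤ (k : ℝ) + 1
    have : (0 : ℝ) ≤ k := k.cast_nonneg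
    linarith
  have hctop : Tendsto c atTop atTop :=
    tendsto_atTop_add_const_right _ _ tendsto_natCast_atTop_atTop
  set v : ℕ → ℝ → E³ → E³ := fun k => c k • stPull (c k ^ 2) (c k) 0 (0 : E³) N with hv
  set qk : ℕ → ℝ → E³ → ℝ := fun k => c k ^ 2 • stPull (c k ^ 2) (c k) 0 (0 : E³) q with hqk
  set Gk : ℕ → ℝ → E³ → E³ →L[ℝ] E³ := fun k => c k ^ 2 • stPull (c k ^ 2) (c k) 0 (0 : E³) H with hGk
  have hslab : ∀ k, stPreimage (c k ^ 2) (c k) 0 (0 : E³) (slab E³ (Iio 0) isOpen_Iio) =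
      slab E³ (Iio 0) isOpen_Iio := fun k =>
    TopologicalSpace.Opens.ext (stAffine_preimage_lowerHalf (hcpos k))
  have hswsk : ∀ k, IsSuitableWeakSolutionOn (slab E³ (Iio 0) isOpen_Iio) 1 0 (v k) (qk k) := by
    intro k
    have h := zoom_isSuitableWeakSolutionOn hsws (hcpos k) 0 (0 : E³)
    rwa [hslab k] at h
  have hgradk : ∀ k, HasWeakSpatialGradientOn (slab E³ (Iio 0) isOpen_Iio) (v k) (Gk k) := by
    intro k
    have h := zoom_hasWeakSpatialGradientOn hgrad (hcpos k) 0 (0 : E³)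
    rwa [hslab k] at h
  have hIk : ∀ k, typeIBound (Iio (0 : ℝ) ×ˢ univ) (v k) (qk k) (Gk k) ≤ I := fun k =>
    (typeIBound_lowerHalf_nsZoom (hcpos k) N q H).le
  -- the engine
  obtain ⟨u, p, G, σ, hσ, hsws', hgrad', hI', hconv, hpers⟩ := hE I v qk Gk hI hswsk hgradk hIk
  -- persistence: the origin is backward-singular
  have hsing : IsBackwardSingularPoint u 0 := by
    refine hpers fun R hR => ?_
    exact (tendsto_eLpNorm_top_originZoom_atTop (u := N) hz₁ (fun j => hcpos (σ j))
      (hctop.comp hσ.tendsto_atTop) hNz hR).limsup_eq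
  -- the majorant passes to the limit a.e., ball by ball
  have hbound : ∀ k (w : ℝ × E³), w.1 < 0 → ‖uncurry (v k) w‖ ≤ F w := by
    rintro k ⟨t, x⟩ ht
    have h := hF (c k) (hc1 k) t ht x
    simpa [hv, stPull_apply] using h
  have hball : ∀ n : ℕ, ∀ᵐ w ∂(volume.restrict (parabolicCylinder ((n : ℝ) + 1) (0 : ℝ × E³))),
      ‖uncurry u w‖ ≤ F w := by
    intro n
    set Q : Set (ℝ × E³) := parabolicCylinder ((n : ℝ) + 1) (0 : ℝ × E³) with hQ
    have hQslab : Q ⊆ Iio (0 : ℝ) ×ˢ (univ : Set E³) := parabolicCylinder_origin_subset_slab _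
    have hQmeas : MeasurableSet Q := by
      rw [hQ]
      exact measurableSet_Ioo.prod measurableSet_ball
    have hvm : ∀ j, AEStronglyMeasurable (uncurry (v (σ j))) (volume.restrict Q) := fun j =>
      ((hgradk (σ j)).locallyIntegrableOn.aestronglyMeasurable).mono_measure
        (Measure.restrict_mono hQslab le_rfl)
    have hum : AEStronglyMeasurable (uncurry u) (volume.restrict Q) :=
      (hgrad'.locallyIntegrableOn.aestronglyMeasurable).mono_measure
        (Measure.restrict_mono hQslab le_rfl)
    have hTIM : TendstoInMeasure (volume.restrict Q) (fun j => uncurry (v (σ j))) atTop (uncurry u) :=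
      tendstoInMeasure_of_tendsto_eLpNorm (by norm_num) hvm hum (hconv ((n : ℝ) + 1) (by positivity))
    obtain ⟨ns, -, hae⟩ := hTIM.exists_seq_tendsto_ae
    filter_upwards [hae, ae_restrict_mem hQmeas] with w hw hwQ
    have hw1 : w.1 < 0 := (hQslab hwQ).1
    exact le_of_tendsto' hw.norm fun i => hbound _ w hw1
  have hae : ∀ᵐ w ∂(volume.restrict (Iio (0 : ℝ) ×ˢ (univ : Set E³))), ‖uncurry u w‖ ≤ F w :=
    ae_restrict_of_ae_restrict_of_subset slab_subset_iUnion_parabolicCylinder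
      ((ae_restrict_iUnion_iff _ _).2 hball)
  refine ⟨u, p, G, hsws', hgrad', lt_of_le_of_lt hI' ?_, hsing, hae⟩
  exact ENNReal.mul_lt_top (by simp) hI

/-- **`stub_apexOfDecaying` holds outright** (candidate proof for the lead; the stub is
`SlabEngine → ApexOfDecayingCore` verbatim): the shifted decay `C'/(1+‖x‖+√(−t))` of `N` gives the
exact apex bound `C'/(‖x‖+√(−t))` for every zoom `c ≥ 1` (`c C'/(1 + c‖x‖ + c√−t) ≤ C'/(‖x‖+√−t)`),
the blow-down obeys it a.e., and `exists_apex_profile_repr` picks the pointwise representative. -/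
theorem apexOfDecayingCore_of_slabEngine (hE : SlabEngine) : ApexOfDecayingCore := by
  rintro ⟨C', N, q, H, hsws, hgrad, hI, hnt, hdecay⟩
  -- `0 ≤ C'` from the decay at one point
  have hC' : 0 ≤ C' := by
    have h := hdecay (-1) (by norm_num) 0
    have hden : 0 < 1 + ‖(0 : E³)‖ + Real.sqrt (-(-1 : ℝ)) := by positivity
    have := (norm_nonneg _).trans h
    exact (div_nonneg_iff.1 this).elim (fun h => h.1) fun h => absurd h.2 (not_le.2 hden)
  have hF : ∀ c : ℝ, 1 ≤ c → ∀ t : ℝ, t < 0 → ∀ x : E³,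
      ‖c • N (c ^ 2 * t) (c • x)‖ ≤ C' / (‖x‖ + Real.sqrt (-t)) := by
    intro c hc t ht x
    have hc0 : 0 < c := by linarith
    have hct : c ^ 2 * t < 0 := mul_neg_of_pos_of_neg (by positivity) ht
    have key := hdecay (c ^ 2 * t) hct (c • x)
    have hsq : Real.sqrt (-(c ^ 2 * t)) = c * Real.sqrt (-t) := by
      rw [show -(c ^ 2 * t) = c ^ 2 * -t by ring, Real.sqrt_mul (sq_nonneg c), Real.sqrt_sq hc0.le]
    rw [norm_smul, Real.norm_of_nonneg hc0.le, hsq] at key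
    rw [norm_smul, Real.norm_of_nonneg hc0.le]
    have hst : 0 < Real.sqrt (-t) := Real.sqrt_pos.2 (by linarith)
    have hden1 : 0 < 1 + c * ‖x‖ + c * Real.sqrt (-t) := by positivity
    have hden2 : 0 < ‖x‖ + Real.sqrt (-t) := by positivity
    calc c * ‖N (c ^ 2 * t) (c • x)‖ ≤ c * (C' / (1 + c * ‖x‖ + c * Real.sqrt (-t))) :=
          mul_le_mul_of_nonneg_left key hc0.le
      _ ≤ C' / (‖x‖ + Real.sqrt (-t)) := by
          rw [mul_div_assoc', div_le_div_iff₀ hden1 hden2]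
          nlinarith [norm_nonneg x, hst.le]
  obtain ⟨u, p, G, hsws', hgrad', hI', hsing, hae⟩ :=
    blowDown_of_slabEngine (F := fun w => C' / (‖w.2‖ + Real.sqrt (-w.1))) hE hsws hgrad hI hnt hF
  have hae' : ∀ᵐ w ∂(volume.restrict (Iio (0 : ℝ) ×ˢ (univ : Set E³))),
      ‖u w.1 w.2‖ ≤ C' / (‖w.2‖ + Real.sqrt (-w.1)) :=
    hae.mono fun w hw => by simpa [Function.uncurry] using hw
  obtain ⟨u', -, h1, h2, h3, h4, h5⟩ := exists_apex_profile_repr hC' hsws' hgrad' hI' hsing hae'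
  exact ⟨C', u', p, G, h1, h2, h3, h4, h5⟩

/-- **A–B reverse WITH the rate, modulo the engine**: every non-trivial member of 𝒜(C,B) yields a
rate-Type-I singular slab profile (`F = C/√(−t)` is scale-invariant; `exists_rate_profile_repr`). -/
theorem classGivesRateProfile_of_slabEngine (hE : SlabEngine) : ClassGivesRateProfile := by
  rintro C B M ⟨hcont, -, -, -, hrate, q, H, hsws, hgrad, hI⟩ ⟨s, hs, y, hy⟩
  have hnt := not_ae_eq_zero_of_continuousOn_slab hcont hs hy
  have hC : 0 ≤ C := by
    have h := hrate (-1) (by norm_num) (0 : E³)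
    have hden : 0 < Real.sqrt (-(-1 : ℝ)) := Real.sqrt_pos.2 (by norm_num)
    have := (norm_nonneg _).trans h
    exact (div_nonneg_iff.1 this).elim (fun h => h.1) fun h => absurd h.2 (not_le.2 hden)
  have hF : ∀ c : ℝ, 1 ≤ c → ∀ t : ℝ, t < 0 → ∀ x : E³,
      ‖c • M (c ^ 2 * t) (c • x)‖ ≤ C / Real.sqrt (-t) := fun c hc t ht x =>
    (hrate.nsRescale (by linarith : 0 < c)) t ht x
  obtain ⟨u, p, G, hsws', hgrad', hI', hsing, hae⟩ :=
    blowDown_of_slabEngine (F := fun w => C / Real.sqrt (-w.1)) hE hsws hgrad hI hnt hF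
  have hae' : ∀ᵐ w ∂(volume.restrict (Iio (0 : ℝ) ×ˢ (univ : Set E³))),
      ‖u w.1 w.2‖ ≤ C / Real.sqrt (-w.1) :=
    hae.mono fun w hw => by simpa [Function.uncurry] using hw
  obtain ⟨u', -, h1, h2, h3, h4, h5⟩ := exists_rate_profile_repr hC hsws' hgrad' hI' hsing hae'
  exact ⟨C, u', p, G, h1, h2, h3, h4, h5⟩

/-! ### Conformance with the skeleton (textual; the `Lines/` module is not importable)

The full type of `stub_apexOfDecaying`, restated verbatim (= `SlabEngine → ApexOfDecayingCore` by `Iff.rfl`)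
and CLOSED by §2: -/
example :
    (∀ (I : ℝ≥0∞) (v : ℕ → ℝ → E³ → E³) (q : ℕ → ℝ → E³ → ℝ) (G : ℕ → ℝ → E³ → E³ →L[ℝ] E³),
      I < ⊤ →
      (∀ k, IsSuitableWeakSolutionOn (slab E³ (Iio 0) isOpen_Iio) 1 0 (v k) (q k)) →
      (∀ k, HasWeakSpatialGradientOn (slab E³ (Iio 0) isOpen_Iio) (v k) (G k)) →
      (∀ k, typeIBound (Iio (0 : ℝ) ×ˢ univ) (v k) (q k) (G k) ≤ I) →
      ∃ (u : ℝ → E³ → E³) (p : ℝ → E³ → ℝ) (H : ℝ → E³ → E³ →L[ℝ] E³) (σ : ℕ → ℕ),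
        StrictMono σ ∧
        IsSuitableWeakSolutionOn (slab E³ (Iio 0) isOpen_Iio) 1 0 u p ∧
        HasWeakSpatialGradientOn (slab E³ (Iio 0) isOpen_Iio) u H ∧
        typeIBound (Iio (0 : ℝ) ×ˢ univ) u p H ≤ 4 * I ∧
        (∀ R : ℝ, 0 < R → Tendsto (fun j => eLpNorm (uncurry (v (σ j)) - uncurry u) 3
          (volume.restrict (parabolicCylinder R (0 : ℝ × E³)))) atTop (𝓝 0)) ∧
        ((∀ R : ℝ, 0 < R → limsup (fun j => eLpNorm (uncurry (v (σ j))) ⊤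
            (volume.restrict (parabolicCylinder R (0 : ℝ × E³)))) atTop = ⊤) →
          IsBackwardSingularPoint u 0)) →
    (∃ (C' : ℝ) (N : ℝ → E³ → E³) (q : ℝ → E³ → ℝ) (H : ℝ → E³ → E³ →L[ℝ] E³),
      IsSuitableWeakSolutionOn (slab E³ (Iio 0) isOpen_Iio) 1 0 N q ∧
      HasWeakSpatialGradientOn (slab E³ (Iio 0) isOpen_Iio) N H ∧
      typeIBound (Iio (0 : ℝ) ×ˢ univ) N q H < ⊤ ∧
      ¬ (uncurry N =ᵐ[volume.restrict (Iio (0 : ℝ) ×ˢ (univ : Set E³))] 0) ∧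
      ∀ t : ℝ, t < 0 → ∀ x : E³, ‖N t x‖ ≤ C' / (1 + ‖x‖ + Real.sqrt (-t))) →
    ∃ (C' : ℝ) (u : ℝ → E³ → E³) (p : ℝ → E³ → ℝ) (G : ℝ → E³ → E³ →L[ℝ] E³),
      IsSuitableWeakSolutionOn (slab E³ (Iio 0) isOpen_Iio) 1 0 u p ∧
      HasWeakSpatialGradientOn (slab E³ (Iio 0) isOpen_Iio) u G ∧
      typeIBound (Iio (0 : ℝ) ×ˢ univ) u p G < ⊤ ∧ HasTypeIDecay C' u ∧
      IsBackwardSingularPoint u 0 :=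
  fun hE h => apexOfDecayingCore_of_slabEngine hE h


end Summit.NavierStokesRegularity.NavierStokesRegularity.Theorems.ApexLocalisation.Negative
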